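import Summits.NavierStokesRegularity.NavierStokesRegularity.Theses.RellichScar
import Summits.NavierStokesRegularity.NavierStokesRegularity.Theorems.SymmetricScarExists.Negative.SpiralWorld
import Summits.NavierStokesRegularity.NavierStokesRegularity.Theorems.RellichScarScarRigidityApexBounds
import Summits.NavierStokesRegularity.NavierStokesRegularity.Theorems.RellichScarScarRigidityApexBoundsFar
import Literature.Analysis.FluidPDE.TypeIAncientMild
import Literature.Analysis.FluidPDE.SuitableWeak

/-!
# `SymmetricScarExists` — line `analytic-scar-window-rigidity`, stub `stub_limitRepresentative`
# (crux stmt-NavierStokesRegularity-11718, route RellichScar)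

**`L³_loc` convergence of Type-I ancient mild fields with a common apex constant is pointwise
convergence on the open slab `t < 0`.**

Let `V_j`, `W : (-∞, 0) × ℝ³ → ℝ³` be Type-I ancient mild fields in the Oseen gauge
(`IsTypeIAncientMild C ·`) obeying the apex bound (`HasTypeIDecay C ·`) for ONE constant `C > 0`,
and assume `‖V_j - W‖_{L³(Q(0,R))} → 0` for every `R > 0`, `Q(0,R) = (-R², 0) × B_R(0)` the backward
parabolic cylinder (`parabolicCylinder R 0`). Then `V_j(t,x) → W(t,x)` at every point `t < 0`, `x`.

Proof (folklore: equi-Lipschitz representatives + Chebyshev).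

* `exists_local_modulus`: the landed apex-weighted derivative bounds with one constant `L = L(C)`
  — `‖∇V(s,·)‖ ≤ L/(‖y‖+√(-s))²` (`RellichScarScarRigidity.exists_norm_iteratedFDeriv_le_apex`) and
  `‖∂ₛV(·,y)‖ ≤ L/(‖y‖+√(-s))³` (`RellichScarScarRigidity.exists_norm_deriv_le_apex`, the pressure
  being the glued Fabes–Jones–Rivière pressure of
  `RellichScarScarRigidity.exists_isClassicalNSSolutionOn_Iio`) — and the mean value inequality
  in `y` (whole space) and in `s` (the interval `[t-ρ, t+ρ]`, where `-s ≥ -t/2`) give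
  `‖F(s,y) - F(t,x)‖ ≤ M ρ` on the box `B_ρ = (t-ρ, t+ρ) × B_ρ(x)`, `0 < ρ ≤ -t/2`, with
  `M = M(C,t)` independent of the field `F`.
* `stub_limitRepresentative`: if `‖V_j(t,x) - W(t,x)‖ ≥ ε`, then `‖V_j - W‖ ≥ ε/2` on `B_ρ` once
  `Mρ ≤ ε/4`, whence `‖V_j - W‖_{L³(Q(0,R))} ≥ (ε/2)·|B_ρ|^{1/3} > 0` for `B_ρ ⊆ Q(0,R)` (Chebyshev,
  Mathlib's `MeasureTheory.le_eLpNorm_of_bddBelow`; `|B_ρ| > 0` as a product of an interval and a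
  ball) — impossible for `j` large.

No named facts are used; the inputs are the three landed `RellichScarScarRigidity` theorems above.

## References

* G. Koch, N. Nadirashvili, G. Seregin, V. Šverák, *Liouville theorems for the Navier–Stokes
  equations and applications*, Acta Math. 203 (2009) 83–105 = arXiv:0709.3599, Prop. 4.1 (the
  a priori derivative bounds behind the equi-Lipschitz estimate). [KochNadirashviliSereginSverak2009]
-/

noncomputable section

open MeasureTheory Set Function Filter Topology TopologicalSpace Metric
open scoped NNReal ENNReal

namespace Summit.NavierStokesRegularity.NavierStokesRegularity.Theorems.SymmetricScarExists.ScarWindow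

open Literature.Analysis.FluidPDE
open Summit.NavierStokesRegularity.NavierStokesRegularity.Theses.RellichScar
open Summit.NavierStokesRegularity.NavierStokesRegularity.Theorems.SymmetricScarExists.Negative

set_option linter.dupNamespace false

/-- **Local equi-Lipschitz modulus of Type-I ancient mild fields.** For `t < 0`, `x ∈ ℝ³` and a
constant `C` there is `M = M(C, t) ≥ 0` such that EVERY Type-I ancient mild field `F` in the Oseen
gauge with the apex bound of constant `C` satisfies `‖F(s,y) - F(t,x)‖ ≤ M ρ` whenever
`0 < ρ ≤ -t/2`, `s ∈ (t-ρ, t+ρ)`, `y ∈ B_ρ(x)`: the mean value inequality with the uniform bounds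
`‖∇F(s,·)‖ ≤ L/(√(-t/2))²`, `‖∂ₛF(·,x)‖ ≤ L/(√(-t/2))³` (`-s ≥ -t/2` on the box) of the landed
apex-weighted derivative estimates (Koch–Nadirashvili–Seregin–Šverák 2009, Prop. 4.1, in the form
`RellichScarScarRigidity.exists_norm_iteratedFDeriv_le_apex` / `exists_norm_deriv_le_apex`). [folklore] -/
theorem exists_local_modulus (C : ℝ) {t : ℝ} (ht : t < 0) (x : EuclideanSpace ℝ (Fin 3)) :
    ∃ M : ℝ, 0 ≤ M ∧ ∀ ⦃F : ℝ → EuclideanSpace ℝ (Fin 3) → EuclideanSpace ℝ (Fin 3)⦄,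
      IsTypeIAncientMild C F → HasTypeIDecay C F → ∀ ⦃ρ : ℝ⦄, 0 < ρ → ρ ≤ -t / 2 →
        ∀ s ∈ Ioo (t - ρ) (t + ρ), ∀ y ∈ ball x ρ, ‖F s y - F t x‖ ≤ M * ρ := by
  obtain ⟨L₁, hL₁0, hL₁⟩ := RellichScarScarRigidity.exists_norm_iteratedFDeriv_le_apex C
  obtain ⟨L₂, hL₂0, hL₂⟩ := RellichScarScarRigidity.exists_norm_deriv_le_apex C
  set τ : ℝ := -t / 2 with hτ
  have hτ0 : 0 < τ := by rw [hτ]; linarith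
  have hsq0 : 0 < Real.sqrt τ := Real.sqrt_pos.2 hτ0
  refine ⟨L₁ / Real.sqrt τ ^ 2 + L₂ / Real.sqrt τ ^ 3, by positivity,
    fun F hF hFd ρ _hρ hρτ s hs y hy => ?_⟩
  obtain ⟨Q, hQ⟩ := RellichScarScarRigidity.exists_isClassicalNSSolutionOn_Iio hF
  -- times in the window are negative, with `τ ≤ -s'`
  have hwin : ∀ s' ∈ Icc (t - ρ) (t + ρ), s' < 0 ∧ Real.sqrt τ ≤ Real.sqrt (-s') := by
    intro s' hs'
    have h2 : τ ≤ -s' := by rw [hτ]; linarith [hs'.2]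
    exact ⟨by linarith, Real.sqrt_le_sqrt h2⟩
  have hsI : s ∈ Icc (t - ρ) (t + ρ) := Ioo_subset_Icc_self hs
  have htI : t ∈ Icc (t - ρ) (t + ρ) := ⟨by linarith, by linarith⟩
  obtain ⟨hs0, hsτ⟩ := hwin s hsI
  -- spatial Lipschitz bound at the time `s` (mean value inequality on the whole space)
  have hspace : ‖F s y - F s x‖ ≤ L₁ / Real.sqrt τ ^ 2 * ‖y - x‖ := by
    refine Convex.norm_image_sub_le_of_norm_fderiv_le (𝕜 := ℝ) (s := univ) (fun z _ => ?_)
      (fun z _ => ?_) convex_univ (mem_univ x) (mem_univ y)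
    · exact ((hQ.contDiff_velocity (show s ∈ Iio (0 : ℝ) from hs0)).differentiable
        (by simp)).differentiableAt
    · have h := hL₁ hF hFd 1 (by norm_num) s hs0 z
      rw [norm_iteratedFDeriv_one (𝕜 := ℝ)] at h
      refine h.trans (div_le_div_of_nonneg_left hL₁0 (pow_pos hsq0 _) ?_)
      exact pow_le_pow_left₀ hsq0.le (le_add_of_nonneg_of_le (norm_nonneg _) hsτ) _
  -- temporal Lipschitz bound at the point `x` (mean value inequality on `[t - ρ, t + ρ]`)
  have htime : ‖F s x - F t x‖ ≤ L₂ / Real.sqrt τ ^ 3 * ‖s - t‖ := by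
    refine Convex.norm_image_sub_le_of_norm_deriv_le (f := fun s' => F s' x)
      (s := Icc (t - ρ) (t + ρ)) (fun s' hs' => ?_) (fun s' hs' => ?_) (convex_Icc _ _) htI hsI
    · have hs'0 : s' ∈ Iio (0 : ℝ) := (hwin s' hs').1
      exact (hQ.smooth_velocity.differentiableWithinAt_time hs'0 x).differentiableAt
        (Iio_mem_nhds hs'0)
    · obtain ⟨hs'0, hs'τ⟩ := hwin s' hs'
      refine (hL₂ hF hFd hQ s' hs'0 x).trans (div_le_div_of_nonneg_left hL₂0 (pow_pos hsq0 _) ?_)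
      exact pow_le_pow_left₀ hsq0.le (le_add_of_nonneg_of_le (norm_nonneg _) hs'τ) _
  have hyx : ‖y - x‖ ≤ ρ := by rw [← dist_eq_norm]; exact (mem_ball.1 hy).le
  have hst : ‖s - t‖ ≤ ρ := by
    rw [Real.norm_eq_abs, abs_le]
    constructor <;> linarith [hs.1, hs.2]
  calc ‖F s y - F t x‖ ≤ ‖F s y - F s x‖ + ‖F s x - F t x‖ := norm_sub_le_norm_sub_add_norm_sub _ _ _
    _ ≤ L₁ / Real.sqrt τ ^ 2 * ‖y - x‖ + L₂ / Real.sqrt τ ^ 3 * ‖s - t‖ := add_le_add hspace htime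
    _ ≤ L₁ / Real.sqrt τ ^ 2 * ρ + L₂ / Real.sqrt τ ^ 3 * ρ := by gcongr
    _ = (L₁ / Real.sqrt τ ^ 2 + L₂ / Real.sqrt τ ^ 3) * ρ := by ring

/-- **Registered stub `stub_limitRepresentative`** (line `analytic-scar-window-rigidity` of the crux
`SymmetricScarExists`, stmt-NavierStokesRegularity-11718; KNOWN mathematics). Type-I ancient mild
fields `V_j`, `W` in the Oseen gauge with the apex bound of ONE constant `C > 0` which converge in
`L³(Q(0,R))` for every `R > 0` converge pointwise at every point of the open slab `t < 0`:
equi-Lipschitz representatives (`exists_local_modulus`) and Chebyshev's inequality on a small box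
`(t-ρ, t+ρ) × B_ρ(x) ⊆ Q(0,R)` (`MeasureTheory.le_eLpNorm_of_bddBelow`). [folklore] -/
theorem stub_limitRepresentative :
    ∀ C : ℝ, 0 < C → ∀ (V : ℕ → ℝ → EuclideanSpace ℝ (Fin 3) → EuclideanSpace ℝ (Fin 3)) (W : ℝ → EuclideanSpace ℝ (Fin 3) → EuclideanSpace ℝ (Fin 3)),
      (∀ j : ℕ, IsTypeIAncientMild C (V j) ∧ HasTypeIDecay C (V j)) → IsTypeIAncientMild C W → HasTypeIDecay C W →
      (∀ R : ℝ, 0 < R → Tendsto (fun j => eLpNorm (uncurry (V j) - uncurry W) 3 (volume.restrict (parabolicCylinder R (0 : ℝ × EuclideanSpace ℝ (Fin 3))))) atTop (𝓝 0)) →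
      ∀ t : ℝ, t < 0 → ∀ x : EuclideanSpace ℝ (Fin 3), Tendsto (fun j => V j t x) atTop (𝓝 (W t x)) := by
  intro C _ V W hV hW hWd hL3 t ht x
  obtain ⟨M, hM0, hM⟩ := exists_local_modulus C ht x
  refine Metric.tendsto_nhds.2 fun ε hε => ?_
  -- the radius of the box: `M ρ ≤ ε / 4` and `ρ ≤ -t / 2`
  set ρ : ℝ := min (-t / 2) (ε / (4 * (M + 1))) with hρdef
  have hρ0 : 0 < ρ := lt_min (by linarith) (by positivity)
  have hρτ : ρ ≤ -t / 2 := min_le_left _ _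
  have hMρ : M * ρ ≤ ε / 4 := by
    calc M * ρ ≤ (M + 1) * (ε / (4 * (M + 1))) :=
          mul_le_mul (by linarith) (min_le_right _ _) hρ0.le (by positivity)
      _ = ε / 4 := by field_simp
  -- the box around `(t, x)` and a parabolic cylinder `Q(0, R)` containing it
  set B : Set (ℝ × EuclideanSpace ℝ (Fin 3)) := Ioo (t - ρ) (t + ρ) ×ˢ ball x ρ with hBdef
  have hx0 : 0 ≤ ‖x‖ := norm_nonneg x
  set R : ℝ := ‖x‖ + ρ + (ρ - t) + 1 with hRdef
  have hR0 : 0 < R := by rw [hRdef]; linarith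
  have hRR : R ≤ R ^ 2 := by rw [hRdef]; nlinarith
  have hBQ : B ⊆ parabolicCylinder R (0 : ℝ × EuclideanSpace ℝ (Fin 3)) := by
    intro z hz
    rw [hBdef, mem_prod, mem_Ioo, mem_ball] at hz
    rw [mem_parabolicCylinder]
    simp only [Prod.fst_zero, Prod.snd_zero, zero_sub]
    refine ⟨⟨by linarith [hz.1.1], by linarith [hz.1.2]⟩, ?_⟩
    calc dist z.2 0 ≤ dist z.2 x + dist x 0 := dist_triangle _ _ _
      _ < ρ + ‖x‖ := by rw [dist_zero_right]; exact add_lt_add_of_lt_of_le hz.2 le_rfl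
      _ < R := by rw [hRdef]; linarith
  have hBm : MeasurableSet B := measurableSet_Ioo.prod measurableSet_ball
  have hBpos : 0 < volume B := by
    rw [hBdef, Measure.volume_eq_prod, Measure.prod_prod]
    refine ENNReal.mul_pos ?_ (measure_ball_pos volume x hρ0).ne'
    rw [Real.volume_Ioo]
    exact (ENNReal.ofReal_pos.2 (by linarith)).ne'
  -- the Chebyshev threshold `δ = (ε/2) |B|^{1/3}` for the measure `volume.restrict Q(0,R)`
  set μ : Measure (ℝ × EuclideanSpace ℝ (Fin 3)) :=
    volume.restrict (parabolicCylinder R (0 : ℝ × EuclideanSpace ℝ (Fin 3))) with hμ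
  have hμB : μ B = volume B := by rw [hμ, Measure.restrict_apply hBm, inter_eq_left.2 hBQ]
  set c : ℝ≥0 := ⟨ε / 2, by positivity⟩ with hc
  have hcpos : (0 : ℝ≥0) < c := by rw [← NNReal.coe_pos]; exact half_pos hε
  set δ : ℝ≥0∞ := c • μ B ^ (1 / (3 : ℝ≥0∞).toReal) with hδ
  have hδ0 : 0 < δ := by
    rw [hδ, ENNReal.smul_def, smul_eq_mul, hμB]
    exact ENNReal.mul_pos (ENNReal.coe_ne_zero.2 hcpos.ne')
      (ENNReal.rpow_pos_of_nonneg hBpos (by positivity)).ne'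
  have hev : ∀ᶠ j in atTop, eLpNorm (uncurry (V j) - uncurry W) 3 μ < δ :=
    (hL3 R hR0).eventually (gt_mem_nhds hδ0)
  refine hev.mono fun n hn => ?_
  by_contra hcon
  rw [not_lt] at hcon
  -- on the box, `‖V_n - W‖ ≥ ε / 2`
  have hpt : ∀ z ∈ B, ε / 2 ≤ ‖(uncurry (V n) - uncurry W) z‖ := by
    intro z hz
    rw [hBdef, mem_prod, mem_ball] at hz
    obtain ⟨hs, hy⟩ := hz
    have h1 : dist (V n t x) (V n z.1 z.2) ≤ M * ρ := by
      rw [dist_comm, dist_eq_norm]; exact hM (hV n).1 (hV n).2 hρ0 hρτ z.1 hs z.2 hy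
    have h2 : dist (W z.1 z.2) (W t x) ≤ M * ρ := by
      rw [dist_eq_norm]; exact hM hW hWd hρ0 hρτ z.1 hs z.2 hy
    have h4 := dist_triangle4 (V n t x) (V n z.1 z.2) (W z.1 z.2) (W t x)
    rw [Pi.sub_apply, ← dist_eq_norm]
    show ε / 2 ≤ dist (V n z.1 z.2) (W z.1 z.2)
    linarith
  -- Chebyshev: `δ ≤ ‖V_n - W‖_{L³(Q(0,R))}`, contradicting `hn`
  have key := le_eLpNorm_of_bddBelow (μ := μ) (p := (3 : ℝ≥0∞)) (by norm_num) (by norm_num)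
    (f := uncurry (V n) - uncurry W) c hBm
    (Eventually.of_forall fun z hz => by rw [← NNReal.coe_le_coe, coe_nnnorm]; exact hpt z hz)
  exact absurd hn (not_lt.2 key)

end Summit.NavierStokesRegularity.NavierStokesRegularity.Theorems.SymmetricScarExists.ScarWindow

end
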